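import Summits.Schanuel.Schanuel.Theorems.RootDecomp1KTwoBaseCell09

/-!
# RootDecomp1KMeasuredWallCell — lens 1, generation 38 «MEASURED WALL CELL of 33364» (the mixed wall (1, ℓ₂, ℓ₃, ρ) for every ρ in the tree class LogHyperLiouville) — part 1 (RootDecomp1KMeasuredWallCell01): §1 p-adic valuation lemmas (`le_padicValRat_top_of_sum_eq_zero`, `two_pow_dvd_three_pow_sub_one`) and §2 the truncations `psQ`, `padicValRat_psQ_three_sub_le`

PORT NOTE (census-1 gen 16, 2026-08-31): port of [HOME/decomp-schanuel-lens-1/g38/RootDecomp1KMeasuredWallCell.lean sha256 168ec8e8…3303, 1895 l + MWprobe 0edab326… + MWctrl b192be9d… + NODE-g38.md 03a7462f…; NOTE/CLAIM L1764, ACK + CHECKLIST K-g38 L1782, NODE L1785 / REQUEST L1786 / RESULT L1787; writer re-check L1790]; own farm rc 0 · 0 warn · 0 sorry · axioms std;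
critic VERDICT STATUS L1793 (CHECKLIST K-g38 MET, ONE cell-decision credit to lens-1 g38 under K-R24 (γ′); RULE K-R25; PORT GO). Seven parts `RootDecomp1KMeasuredWallCell01`–`07`: 01 = §1 p-adic valuation lemmas + §2 the simultaneous
truncations `psQ b K` and the 2-adic size of `s³_{K′} − s³_K`, 02 = §3 (W) the 2-ADIC WINDOW ZERO ESTIMATE `window_nonvanishing`, 03 = §4 block tools, 04 = §4
(M) the BLOCK MEASURE `logPowMeasure_cons_two_three (hθ : MvPolyMeasure θ)` (θ⃗ quantified) + instances, 05 = §5 the cells against item 33364's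
binders VERBATIM + one range line (`finiteOrderLiouvilleSchanuel_measuredWallCell (hNW) (hρ : LogHyperLiouville ρ)`, `_pi` hypothesis-free, class forms
`InMeasuredWallClass(Pi)`) + §6 truncations of `ℓ_T` and the three-scale form bound, 06 = §6 the member `zM = (1, ℓ₂, ℓ₃, ℓ_T)` / `zMpi` with hypothesis-free
certificates, `sb_zM (hNW)`, `sb_zMpi`, 07 = §6 separation (`ellT_ne_liouvilleNumber`, `zM_outside_liouvilleBlockCells`, `zM_outside_fin_three_cells`, …). The kernel
imports the TREE `RootDecomp1KTwoBaseCell09` only and carries NO copy of a tree lemma (its eleven private helpers are primed re-statements); NO Theses import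
anywhere (the LIVE links live in the HOME probe); `(hNW : NWMeasure)` by name. PORT EDITS: `set_option linter.dupNamespace false` dropped, three one-line
docstrings added, per-part private copies; statements and proofs verbatim. `--supports stmt-Schanuel-33364`; no census credit carried; nothing here proves
Schanuel; rung 0. The lens's header follows.
-/

/-!
# RootDecomp1K — lens 1 (grading / quantitative ladder), gen 38: the «MEASURED WALL CELL» of item 33364
# (`FiniteOrderLiouvilleSchanuel`) — Schanuel's bound `SB 4` on the MIXED wall `(1, ℓ₂, ℓ₃, ρ)` for EVERY real `ρ`
# of the TREE class `LogHyperLiouville ρ` (class data ONLY, `ρ` not pinned), mod the by-name fact `NWMeasure`, and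
# on its π-twin `(π, πℓ₂, πℓ₃, πρ)` HYPOTHESIS-FREE; `ℓ_b = liouvilleNumber b`.  RULE K-R24 target (γ′): a wall cell
# that JOINS an UN-PINNED Liouville-class coordinate to a Liouville BLOCK.

HEADER: see `NODE-g38.md` next to this file (cell decomp-schanuel, seat `decomp-schanuel-lens-1`, gen 38,
2026-08-31; RULE K-R24 (γ′), STATUS L1748; claim L1764).  Route of record `route-Schanuel-RootDecomp1K` (DRAFT;
`closes hL hH hF hB`), item **F** = `Summit.Schanuel.Schanuel.Theses.RootDecomp1K.FiniteOrderLiouvilleSchanuel`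
(stmt-Schanuel-33364).  Nothing here proves Schanuel; rung 0.  No 1K decl is restated: the item is consumed BY NAME
in the probe file (`MWprobe.lean` = this file verbatim + `import …Theses.RootDecomp1K` + §Probes); the control file
`MWctrl.lean` (= this file verbatim + §Controls) carries the planted failures.  Imports the TREE only
(`…RootDecomp1KTwoBaseCell09` = this seat's g36 kernel as ported, which transitively provides Hyper01–03, Generic,
RelLiouvilleCell01–08 (g34), LogLogCell01 (g35)); every engine lemma of earlier generations is used BY ITS TREE NAME
(`sb_of_logHyperLiouville_of_logPowMeasure`, `sb_of_range_eq'`, `form_lower_bound`, `ellT`, `logHyperLiouville_ellT`,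
`not_logLogLiouville_liouvilleNumber`, `exists_window_index`, `linLiouville_of_prefix`, `polyMeasure_exp_one_of_NW`,
`mvPolyMeasure_one_of_polyMeasure`, `polyMeasure_pi`, …); nothing is vendored.  The e-versions carry the tree's
by-name fact binder `(hNW : NWMeasure)` exactly as g34–g37 / Hyper01 prescribe; π-versions nothing.

THE MECHANISM (two new engines + the tree's extraction step):
* (W) §3 `window_nonvanishing` — a UNIFORM 2-ADIC WINDOW ZERO ESTIMATE for the pinned pair `(ℓ₃, ℓ₂)`: a non-zero
  `F ∈ ℤ[X][X]` of bidegree `≤ (d, d)` and length `< 2^{M!}` does not vanish at all `d + 1` consecutive truncation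
  points `(ℓ₃^{(K)}, ℓ₂^{(K)})`, `K = M+1, …, M+1+d` (`M ≥ d+2`).  Proof: at each scale the generic valuation lemma
  (GV, §1) turns vanishing into a 2-adic divisibility `2^{K!−(K−1)!·d} ∣ (leading y-slice at ℓ₃^{(K)})`, the slice is a
  non-zero integer of controlled size only if it is `0` (§2: `v₂(ℓ₃^{(K)} − ℓ₃^{(K')})` via `2^{k+2} ∥ 3^{2^k} − 1`-type
  bounds, `two_pow_dvd_three_pow_sub_one`), and `d + 1` vanishing slices at `d + 1` DISTINCT rationals `ℓ₃^{(K)}`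
  kill a degree-`≤ d` polynomial — one scale does NOT suffice (control C8).
* (M) §4 `induced_logPow_measure_cons_two_three` / `logPowMeasure_cons_two_three` — the BLOCK MEASURE: for every
  tuple `θ` with the tree class `MvPolyMeasure θ`, the block `(ℓ₂, ℓ₃, θ)` has the tree class `LogPowMeasure` with
  the explicit exponent `d + 3`: given `P(x, y, θ) ≠ 0`, slice `P = Σ_α c_α(x, y) θ^α` with INTEGER slices
  `sliceXY P α`, pick by (W) a scale `K` in the window where the leading slice is non-zero at the truncations, so the
  specialisation `wspec P K ∈ ℤ[θ]` is non-zero with controlled degree/length, apply `MvPolyMeasure θ` to it, and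
  compare `P(ℓ₂, ℓ₃, θ)` with `P(ℓ₂^{(K)}, ℓ₃^{(K)}, θ)` across the factorial gap (`norm_aeval_sub_aeval_le`-type
  estimate `mvaeval_wspec`, window placed by the tree's `exists_window_index`).
* (X) §5 — extraction with `ρ` LAST against the block measure, by the TREE theorem
  `sb_of_logHyperLiouville_of_logPowMeasure (n := 3)`, then `sb_of_range_eq'`.
Instances: `θ = (e)` (`MvPolyMeasure` from `NWMeasure` via `polyMeasure_exp_one_of_NW`) gives the e-cell;
`θ = (π)` (`polyMeasure_pi`, hypothesis-free) gives the π-cell.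

THE MEMBER (§6, hypothesis-free certificates): `z_M = (1, ℓ₂, ℓ₃, ℓ_T)` and `z_M^π = π·z_M`, `ℓ_T = ellT` the
tree's Thue–Morse-indexed lacunary number (`logHyperLiouville_ellT`): (i) ℚ-linear independence, (ii) the item's
`ω`-binder, (iii) FAILURE of the item's `m`-binder — all from the THREE-SCALE form bound `form_lower_bound_M`
(exponent 11: `g₂ = 0` reduces to the tree's two-term bound `form_lower_bound`; `g₂ ≠ 0` is excluded by comparing
the scales `2^{-N!}` and `3^{-N!}`, `formM_two_scale`); class membership `zM_inMeasuredWallClass`; the LIVE item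
APPLIED at `z_M` typechecks (probe P2) and `SB 4 z_M` is PROVED mod `hNW` (`sb_zM`), `SB 4 z_M^π` with NO
hypothesis (`sb_zMpi`).  SEPARATION (hypothesis-free): `ℓ_T` is log-log-Liouville, no `ℓ_b` is
(`not_logLogLiouville_liouvilleNumber`), so `ℓ_T ≠ ℓ_b`; `z_M`, `z_M^π` lie on no `Fin 3` cell of g33–g37 and on
no Liouville-block cell `(1, ℓ_{b⃗})` / `(π, πℓ_{b⃗})` of any length (`zM_outside_liouvilleBlockCells`).

Sections: §1 valuations (GV) · §2 truncations `psQ`, 2-adic separation of the `ℓ₃`-truncations · §3 (W) · §4 block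
tools (`mvlen` bookkeeping, `wspec`, `sliceXY`) and (M) with its two instances · §5 cells vs the LIVE binders
(positional texts + class lines `InMeasuredWallClass(Pi)`) · §6 members `z_M`, `z_M^π`, certificates, separation.
`set_option maxHeartbeats 800000 in` once (§6 `form_lower_bound_M`); no other option, no linter disabled except
`linter.dupNamespace`.
-/

noncomputable section

open Complex IntermediateField Polynomial
open Summit.Schanuel.Schanuel.Theorems.RootDecomp1KHyper
open Summit.Schanuel.Schanuel.Theorems.RootDecomp1KHyper.HyperCell
open Summit.Schanuel.Schanuel.Theorems.RootDecomp1KGeneric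
open Summit.Schanuel.Schanuel.Theorems.RootDecomp1KRelLiouvilleCell
open Summit.Schanuel.Schanuel.Theorems.RootDecomp1KLogLogCell (LogLogLiouville logLogLiouville_of_logHyperLiouville)
open Summit.Schanuel.Schanuel.Theorems.RootDecomp1KTwoBaseCell

namespace Summit.Schanuel.Schanuel.Theorems.RootDecomp1KMeasuredWallCell

/-! ## §1  p-adic valuation lemmas -/

section Valuations
open scoped Nat

/-- `v_p` of a finite sum is `≥ m` if every non-zero summand has `v_p ≥ m` and the sum is non-zero. -/
theorem le_padicValRat_sum {p : ℕ} [Fact p.Prime] {ι : Type*} (s : Finset ι) (F : ι → ℚ) (m : ℤ)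
    (hF : ∀ i ∈ s, F i ≠ 0 → m ≤ padicValRat p (F i)) (hs : ∑ i ∈ s, F i ≠ 0) :
    m ≤ padicValRat p (∑ i ∈ s, F i) := by
  classical
  induction s using Finset.induction_on with
  | empty => simp at hs
  | insert a s ha ih =>
    rw [Finset.sum_insert ha] at hs ⊢
    by_cases h0 : ∑ i ∈ s, F i = 0
    · rw [h0, add_zero] at hs ⊢
      exact hF a (Finset.mem_insert_self a s) hs
    · by_cases ha0 : F a = 0
      · rw [ha0, zero_add]
        exact ih (fun i hi => hF i (Finset.mem_insert_of_mem hi)) h0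
      · have h1 := hF a (Finset.mem_insert_self a s) ha0
        have h2 := ih (fun i hi => hF i (Finset.mem_insert_of_mem hi)) h0
        exact (le_min h1 h2).trans (padicValRat.min_le_padicValRat_add hs)

/-- `v_p` of a finite product of non-zero rationals is the sum of the valuations. -/
private theorem padicValRat_prod {p : ℕ} [Fact p.Prime] {ι : Type*} (s : Finset ι) (F : ι → ℚ)
    (hF : ∀ i ∈ s, F i ≠ 0) :
    padicValRat p (∏ i ∈ s, F i) = ∑ i ∈ s, padicValRat p (F i) := by
  classical
  induction s using Finset.induction_on with
  | empty => simp
  | insert a s ha ih =>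
    rw [Finset.prod_insert ha, Finset.sum_insert ha,
      padicValRat.mul (hF a (Finset.mem_insert_self a s))
        (Finset.prod_ne_zero_iff.mpr fun i hi => hF i (Finset.mem_insert_of_mem hi)),
      ih fun i hi => hF i (Finset.mem_insert_of_mem hi)]

/-- **Generic valuation lemma (GV).** If `Σ_{i ≤ D} c_i y^i = 0` with `y = a / p^M`, `p ∤ a`, every
non-zero `c_i` of `p`-adic valuation `≥ 0` and `c_D ≠ 0` (so `D ≥ 1`), then `v_p(c_D) ≥ M`. -/
theorem le_padicValRat_top_of_sum_eq_zero {p : ℕ} [hp : Fact p.Prime] {a : ℤ} (ha : ¬ (p : ℤ) ∣ a)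
    (M : ℕ) {D : ℕ} (c : ℕ → ℚ) (hc : ∀ i ≤ D, c i ≠ 0 → 0 ≤ padicValRat p (c i))
    (hcD : c D ≠ 0)
    (hsum : ∑ i ∈ Finset.range (D + 1), c i * ((a : ℚ) / (p : ℚ) ^ M) ^ i = 0) :
    (M : ℤ) ≤ padicValRat p (c D) := by
  set y : ℚ := (a : ℚ) / (p : ℚ) ^ M with hy
  have hp1 : 1 < p := hp.out.one_lt
  have hpQ : (p : ℚ) ≠ 0 := by exact_mod_cast hp.out.ne_zero
  have ha0 : a ≠ 0 := fun h => ha (by rw [h]; exact dvd_zero _)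
  have haQ : (a : ℚ) ≠ 0 := by exact_mod_cast ha0
  have hy0 : y ≠ 0 := div_ne_zero haQ (pow_ne_zero _ hpQ)
  have hva : padicValRat p (a : ℚ) = 0 := by
    rw [padicValRat.of_int, padicValInt.eq_zero_of_not_dvd ha]; simp
  have hvy : padicValRat p y = -(M : ℤ) := by
    rw [hy, padicValRat.div haQ (pow_ne_zero _ hpQ), hva, padicValRat.pow, padicValRat.self hp1]
    ring
  rw [Finset.sum_range_succ] at hsum
  have hTD : c D * y ^ D ≠ 0 := mul_ne_zero hcD (pow_ne_zero _ hy0)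
  have hrest : ∑ i ∈ Finset.range D, c i * y ^ i ≠ 0 := by
    intro h0; rw [h0, zero_add] at hsum; exact hTD hsum
  have hval_rest : -(((D : ℤ) - 1) * M) ≤ padicValRat p (∑ i ∈ Finset.range D, c i * y ^ i) := by
    refine le_padicValRat_sum _ _ _ (fun i hi hne => ?_) hrest
    have hiD : i < D := Finset.mem_range.mp hi
    have hci : c i ≠ 0 := fun h => hne (by rw [h, zero_mul])
    rw [padicValRat.mul hci (pow_ne_zero _ hy0), padicValRat.pow, hvy]
    have h1 := hc i hiD.le hci
    have h2 : (i : ℤ) ≤ (D : ℤ) - 1 := by omega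
    have hM0 : (0 : ℤ) ≤ M := by positivity
    nlinarith
  have heq : c D * y ^ D = -(∑ i ∈ Finset.range D, c i * y ^ i) := by linear_combination hsum
  have hvalD : padicValRat p (c D * y ^ D) = padicValRat p (c D) - D * M := by
    rw [padicValRat.mul hcD (pow_ne_zero _ hy0), padicValRat.pow, hvy]; ring
  have hcmp : padicValRat p (c D * y ^ D) = padicValRat p (∑ i ∈ Finset.range D, c i * y ^ i) := by
    rw [heq, padicValRat.neg]
  rw [hvalD] at hcmp
  rw [← hcmp] at hval_rest
  nlinarith

/-- `3^{2^t m} ≡ 1 (mod 2^{t+2})` for `t ≥ 1`. -/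
theorem two_pow_dvd_three_pow_sub_one {t m : ℕ} (ht : 1 ≤ t) : (2 : ℤ) ^ (t + 2) ∣ 3 ^ (2 ^ t * m) - 1 := by
  have key : ∀ t : ℕ, 1 ≤ t → (2 : ℤ) ^ (t + 2) ∣ 3 ^ (2 ^ t) - 1 := by
    intro t ht
    induction t with
    | zero => omega
    | succ t ih =>
      rcases Nat.eq_zero_or_pos t with h0 | hpos
      · subst h0; norm_num
      · obtain ⟨c, hc⟩ := ih hpos
        have e : (3 : ℤ) ^ (2 ^ (t + 1)) = (3 ^ (2 ^ t)) ^ 2 := by rw [pow_succ, pow_mul]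
        have e2 : (3 : ℤ) ^ (2 ^ t) = 2 ^ (t + 2) * c + 1 := by linear_combination hc
        refine ⟨2 ^ (t + 1) * c ^ 2 + c, ?_⟩
        rw [e, e2]; ring
  obtain ⟨c, hc⟩ := key t ht
  have e2 : (3 : ℤ) ^ (2 ^ t) = 2 ^ (t + 2) * c + 1 := by linear_combination hc
  rw [pow_mul, e2]
  exact (Int.ModEq.pow m (show (2 : ℤ) ^ (t + 2) * c + 1 ≡ 1 [ZMOD 2 ^ (t + 2)] from
    Int.ModEq.symm ((Int.modEq_iff_dvd).mpr ⟨c, by ring⟩))).symm.dvd |> fun h => by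
      simpa [one_pow] using h

end Valuations

/-! ## §2  The simultaneous truncations `s²_K, s³_K` as rationals; the 2-adic size of `s³_{K'} − s³_K` -/

section Truncations
open LiouvilleNumber
open scoped Nat

/-- Rational truncation `s^b_K := Σ_{i ≤ K} b^{-i!}` of `ℓ_b = liouvilleNumber b` (`= partialSum b K`). -/
def psQ (b K : ℕ) : ℚ := ∑ i ∈ Finset.range (K + 1), 1 / (b : ℚ) ^ i !

/-- `psQ b K` is the real partial sum `partialSum b K`. -/
theorem psQ_cast (b K : ℕ) : ((psQ b K : ℚ) : ℝ) = partialSum (b : ℝ) K := by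
  unfold psQ partialSum
  push_cast
  rfl

/-- `psQ b K = psNumer b K / b^{K!}`. -/
theorem psQ_eq_div {b : ℕ} (hb : 0 < b) (K : ℕ) : psQ b K = (psNumer b K : ℚ) / (b : ℚ) ^ K ! := by
  have hb0 : (b : ℚ) ≠ 0 := by exact_mod_cast hb.ne'
  unfold psQ psNumer
  push_cast
  rw [Finset.sum_div]
  refine Finset.sum_congr rfl fun i hi => ?_
  have hi' : i ! ≤ K ! := Nat.factorial_le (by have := Finset.mem_range.mp hi; omega)
  rw [pow_sub₀ _ hb0 hi']
  field_simp

/-- The truncations increase strictly. -/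
theorem psQ_strictMono {b : ℕ} (hb : 0 < b) : StrictMono (psQ b) :=
  strictMono_nat_of_lt_succ fun n => by
    have hb' : (0 : ℚ) < b := by exact_mod_cast hb
    unfold psQ
    rw [Finset.sum_range_succ _ (n + 1)]
    exact lt_add_of_pos_right _ (by positivity)

/-- Difference of two truncations: `s^b_{K'} − s^b_K = U / b^{K'!}`, `U = Σ_{K<i≤K'} b^{K'!−i!} ∈ ℕ`. -/
theorem psQ_sub_psQ {b : ℕ} (hb : 0 < b) {K K' : ℕ} (hKK' : K ≤ K') :
    psQ b K' - psQ b K =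
      ((∑ i ∈ Finset.Ico (K + 1) (K' + 1), b ^ ((K' !) - (i !)) : ℕ) : ℚ) / (b : ℚ) ^ K' ! := by
  have hb0 : (b : ℚ) ≠ 0 := by exact_mod_cast hb.ne'
  unfold psQ
  rw [← Finset.sum_Ico_eq_sub _ (by omega : K + 1 ≤ K' + 1)]
  push_cast
  rw [Finset.sum_div]
  refine Finset.sum_congr rfl fun i hi => ?_
  have hi' : i ! ≤ K' ! := Nat.factorial_le (by have := (Finset.mem_Ico.mp hi).2; omega)
  rw [pow_sub₀ _ hb0 hi']
  field_simp

/-- **The 2-adic key.** For `t ≥ 1`, `2^t ≤ K + 1`, `K < K'` and `K' − K < 2^{t+2}`, the numerator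
`U = Σ_{K<i≤K'} 3^{K'!−i!}` of `s³_{K'} − s³_K` is NOT divisible by `2^{t+2}` (each term is `≡ 1`, since
`2^t ∣ K'! − i!` and `3^{2^t m} ≡ 1 (mod 2^{t+2})`, so `U ≡ K' − K ≢ 0`). -/
theorem not_two_pow_dvd_numer {t K K' : ℕ} (ht : 1 ≤ t) (htK : 2 ^ t ≤ K + 1) (hKK' : K < K')
    (hd : K' - K < 2 ^ (t + 2)) :
    ¬ (2 ^ (t + 2) ∣ ∑ i ∈ Finset.Ico (K + 1) (K' + 1), 3 ^ ((K' !) - (i !))) := by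
  intro hdvd
  have hterm : ∀ i ∈ Finset.Ico (K + 1) (K' + 1), (2 : ℤ) ^ (t + 2) ∣ (3 : ℤ) ^ ((K' !) - (i !)) - 1 := by
    intro i hi
    have hi1 : K + 1 ≤ i := (Finset.mem_Ico.mp hi).1
    have hi2 : i ≤ K' := Nat.lt_succ_iff.mp (Finset.mem_Ico.mp hi).2
    have h2i : 2 ^ t ∣ i ! := Nat.dvd_factorial (Nat.two_pow_pos t) (htK.trans hi1)
    have h2K' : 2 ^ t ∣ K' ! := Nat.dvd_factorial (Nat.two_pow_pos t) (htK.trans (hi1.trans hi2))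
    obtain ⟨m, hm⟩ : 2 ^ t ∣ (K' !) - (i !) := Nat.dvd_sub h2K' h2i
    rw [hm]
    exact two_pow_dvd_three_pow_sub_one ht
  have hdvdZ : (2 : ℤ) ^ (t + 2) ∣ ((∑ i ∈ Finset.Ico (K + 1) (K' + 1), 3 ^ ((K' !) - (i !)) : ℕ) : ℤ) := by
    have := Int.natCast_dvd_natCast.mpr hdvd
    push_cast at this
    push_cast
    exact this
  have hsumZ : ((∑ i ∈ Finset.Ico (K + 1) (K' + 1), 3 ^ ((K' !) - (i !)) : ℕ) : ℤ) =
      (∑ i ∈ Finset.Ico (K + 1) (K' + 1), ((3 : ℤ) ^ ((K' !) - (i !)) - 1)) + ((K' - K : ℕ) : ℤ) := by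
    push_cast [Nat.cast_sub hKK'.le]
    rw [Finset.sum_sub_distrib, Finset.sum_const, Nat.card_Ico, nsmul_eq_mul, mul_one,
      show K' + 1 - (K + 1) = K' - K by omega]
    push_cast [Nat.cast_sub hKK'.le]
    ring
  have hrest : (2 : ℤ) ^ (t + 2) ∣ ∑ i ∈ Finset.Ico (K + 1) (K' + 1), ((3 : ℤ) ^ ((K' !) - (i !)) - 1) :=
    Finset.dvd_sum fun i hi => hterm i hi
  have hdiff : (2 : ℤ) ^ (t + 2) ∣ ((K' - K : ℕ) : ℤ) := by
    have := (Int.dvd_add_right hrest).mp (hsumZ ▸ hdvdZ)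
    exact this
  have hnat : 2 ^ (t + 2) ∣ K' - K := by exact_mod_cast hdiff
  have hpos : 0 < K' - K := by omega
  exact absurd (Nat.le_of_dvd hpos hnat) (not_le.mpr hd)

/-- Hence `v₂(s³_{K'} − s³_K) ≤ t + 1` in the same range. -/
theorem padicValRat_psQ_three_sub_le {t K K' : ℕ} (ht : 1 ≤ t) (htK : 2 ^ t ≤ K + 1) (hKK' : K < K')
    (hd : K' - K < 2 ^ (t + 2)) :
    padicValRat 2 (psQ 3 K' - psQ 3 K) ≤ (t : ℤ) + 1 := by
  rw [psQ_sub_psQ (by norm_num) hKK'.le]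
  set U : ℕ := ∑ i ∈ Finset.Ico (K + 1) (K' + 1), 3 ^ ((K' !) - (i !)) with hU
  have hUpos : 0 < U :=
    Finset.sum_pos (fun i _ => pow_pos (by norm_num) _) ⟨K', Finset.mem_Ico.mpr ⟨by omega, by omega⟩⟩
  have hU0 : (U : ℚ) ≠ 0 := by exact_mod_cast hUpos.ne'
  have h3 : ((3 : ℕ) : ℚ) ^ K' ! ≠ 0 := by positivity
  rw [padicValRat.div hU0 h3, padicValRat.pow, padicValRat.of_nat, padicValRat.of_nat,
    padicValNat.eq_zero_of_not_dvd (by norm_num : ¬ 2 ∣ 3)]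
  simp only [CharP.cast_eq_zero, mul_zero, sub_zero]
  have hnot : ¬ (t + 2 ≤ padicValNat 2 U) := fun h =>
    not_two_pow_dvd_numer ht htK hKK' hd ((padicValNat_dvd_iff_le hUpos.ne').mpr h)
  omega

/-- `v₂(s³_K) ≥ 0` (its denominator is a power of `3`). -/
theorem padicValRat_psQ_three_nonneg (K : ℕ) : 0 ≤ padicValRat 2 (psQ 3 K) := by
  rw [psQ_eq_div (by norm_num)]
  have hnum : (psNumer 3 K : ℚ) ≠ 0 := by
    have : 0 < psNumer 3 K := by
      unfold psNumer
      exact Finset.sum_pos (fun i _ => pow_pos (by norm_num) _) ⟨0, by simp⟩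
    exact_mod_cast this.ne'
  rw [padicValRat.div hnum (by positivity), padicValRat.pow, padicValRat.of_nat, padicValRat.of_nat,
    padicValNat.eq_zero_of_not_dvd (by norm_num : ¬ 2 ∣ 3)]
  simp

/-- The numerator `psNumer b K` is prime to `b` (`K ≥ 2`), as an integer statement. -/
theorem not_dvd_psNumer {b : ℕ} (hb : 2 ≤ b) {K : ℕ} (hK : 2 ≤ K) : ¬ ((b : ℤ) ∣ (psNumer b K : ℤ)) := by
  intro h
  have hnat : b ∣ psNumer b K := by exact_mod_cast h
  have hcop := (coprime_psNumer b hK).symm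
  have := Nat.Coprime.eq_one_of_dvd hcop hnat
  omega

end Truncations

end Summit.Schanuel.Schanuel.Theorems.RootDecomp1KMeasuredWallCell

end
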